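import Mathlib
import Literature.FieldTheory.QuasiAlgClosed.Basic
import HarnessLib

/-!
# Determinants of linear matrix pencils are forms; the affine-chart principle

Topic `Literature/AlgebraicGeometry/DeterminantalHypersurfaces`. Elementary glue used by every
construction of a determinantal representation `p(x,y,z) = det(xI + yB + zC)` of a ternary form
from a representation of one of its affine restrictions (A. S. Lewis, P. A. Parrilo, M. V. Ramana,
*The Lax conjecture is true*, Proc. AMS 133 (2005), proof of Conjecture 2 from Theorem 4:
"by homogeneity, for `x ≠ 0`, `p(x,y,z) = x^d p(1, y/x, z/x) = x^d det(I + (y/x)B + (z/x)C)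
= det(xI + yB + zC)`"; A. Grinshpan et al., Multidimens. Syst. Signal Process. 27 (2016), end of
both proofs of Thm. 4.1: "`p(x₁,x₂) = x₁^d p̌_{x₂/x₁}(1/x₁) = det(I_d + x₁A₁ + x₂A₂)`"):

* `isHomogeneous_det_sum_X_smul` — `det(Σₖ Xₖ Aₖ) ∈ R[X_ι]` is a form of degree `|n|` [folklore];
* `eval_det_sum_X_smul` — its value at `v` is `det(Σₖ vₖ Aₖ)` [folklore];
* `IsHomogeneous.eq_of_eval_eq_on_chart` — two forms of the same degree over an infinite field
  that agree on an affine chart `{v | v i = 1}` are equal [folklore];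
* `eval_eq_det_pencil_of_chart_one` — the assembly step for the Lax conjecture in the chart
  `{y = 1}` used by the matrix-factorisation route (Grinshpan et al. 2016, §4): if `p` is a ternary
  form of degree `d` and `p(t,1,s) = det(tI + B + sC)` for all real `t, s`, then
  `p(x,y,z) = det(xI + yB + zC)` for all real `x, y, z` — literally the conclusion of
  `Literature.AlgebraicGeometry.DeterminantalHypersurfaces.LewisParriloRamana2005_laxConjecture`.

## References

* [LewisParriloRamana2005] A. S. Lewis, P. A. Parrilo, M. V. Ramana, Proc. AMS 133 (2005)
  2495–2499 (arXiv:math/0304104): proof of Conjecture 2 from Theorem 4 (homogenisation step).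
* [GrinshpanEtAl2014] A. Grinshpan, D. S. Kaliuzhnyi-Verbovetskyi, V. Vinnikov, H. J. Woerdeman,
  Multidimens. Syst. Signal Process. 27 (2016) 1–26 (arXiv:1306.6655): §4, proofs of Thm. 4.1.
-/

noncomputable section

open MvPolynomial Matrix

namespace Literature.AlgebraicGeometry.DeterminantalHypersurfaces

section General

variable {R : Type*} [CommRing R] {ι : Type*} [Fintype ι] {n : Type*} [Fintype n] [DecidableEq n]

/-- The determinant of a linear pencil `Σₖ Xₖ Aₖ` of `|n| × |n|` matrices is a form of degree
`|n|` in the variables `Xₖ`. [folklore] -/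
theorem isHomogeneous_det_sum_X_smul (A : ι → Matrix n n R) :
    MvPolynomial.IsHomogeneous
      (det (∑ k, (X k : MvPolynomial ι R) • (A k).map C : Matrix n n (MvPolynomial ι R)))
      (Fintype.card n) := by
  have aux : Fintype.card n = 0 + ∑ _i : n, 1 := by simp
  rw [aux, det_apply']
  apply IsHomogeneous.sum
  rintro g -
  apply IsHomogeneous.mul
  · rw [← map_intCast (C : R →+* MvPolynomial ι R)]
    exact isHomogeneous_C _ _
  · apply IsHomogeneous.prod
    rintro i -
    simp only [Matrix.sum_apply, Matrix.smul_apply, map_apply, smul_eq_mul]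
    apply IsHomogeneous.sum
    rintro k -
    exact (isHomogeneous_X R k).mul (isHomogeneous_C _ _)

/-- Evaluating the pencil determinant: `det(Σₖ Xₖ Aₖ)(v) = det(Σₖ vₖ Aₖ)`. [folklore] -/
theorem eval_det_sum_X_smul (A : ι → Matrix n n R) (v : ι → R) :
    eval v (det (∑ k, (X k : MvPolynomial ι R) • (A k).map C : Matrix n n (MvPolynomial ι R))) =
      det (∑ k, v k • A k) := by
  rw [RingHom.map_det]
  congr 1
  ext i j
  simp [Matrix.sum_apply]

end General

section Chart

variable {K : Type*} [Field K] [Infinite K] {σ : Type*}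

/-- **Affine-chart principle.** Two forms of the same degree over an infinite field that agree
on the affine chart `{v | v i = 1}` are equal: for `v i ≠ 0` rescale by `(v i)⁻¹` and use
`f(t • v) = t^d f(v)`; so `(p − q)·Xᵢ` vanishes identically. [folklore] -/
theorem _root_.MvPolynomial.IsHomogeneous.eq_of_eval_eq_on_chart {p q : MvPolynomial σ K}
    {d : ℕ} (hp : p.IsHomogeneous d) (hq : q.IsHomogeneous d) (i : σ)
    (h : ∀ v : σ → K, v i = 1 → eval v p = eval v q) : p = q := by
  have key : ∀ v : σ → K, eval v ((p - q) * X i) = 0 := by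
    intro v
    rw [map_mul, eval_X, map_sub]
    by_cases hv : v i = 0
    · rw [hv, mul_zero]
    · have hs : eval v p = eval v q := by
        have h1 := h ((v i)⁻¹ • v) (by simp [hv])
        rw [hp.eval_smul_eq, hq.eval_smul_eq] at h1
        exact mul_left_cancel₀ (pow_ne_zero d (inv_ne_zero hv)) h1
      rw [hs, sub_self, zero_mul]
  have h0 : (p - q) * X i = 0 := MvPolynomial.funext fun v => by rw [key, map_zero]
  rcases mul_eq_zero.mp h0 with h' | h'
  · exact sub_eq_zero.mp h'
  · exact absurd h' (X_ne_zero i)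

end Chart

/-- **Homogenisation step of the Lax conjecture in the chart `{y = 1}`** (Grinshpan et al. 2016,
end of the proofs of Thm. 4.1; Lewis–Parrilo–Ramana 2005 use the chart `{x = 1}` in the same way):
if `p ∈ ℝ[x,y,z]` is a form of degree `d` with `p(t,1,s) = det(tI + B + sC)` for all real `t, s`,
then `p(x,y,z) = det(xI + yB + zC)` for all real `x, y, z`.
[cite: GrinshpanEtAl2014, Thm. 4.1 (end of both proofs)] -/
theorem eval_eq_det_pencil_of_chart_one {d : ℕ} {p : MvPolynomial (Fin 3) ℝ}
    (hp : p.IsHomogeneous d) (B C : Matrix (Fin d) (Fin d) ℝ)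
    (h : ∀ t s : ℝ, MvPolynomial.eval ![t, 1, s] p =
      (t • (1 : Matrix (Fin d) (Fin d) ℝ) + B + s • C).det) (x y z : ℝ) :
    MvPolynomial.eval ![x, y, z] p = (x • (1 : Matrix (Fin d) (Fin d) ℝ) + y • B + z • C).det := by
  set A : Fin 3 → Matrix (Fin d) (Fin d) ℝ := ![1, B, C] with hA
  have hQ : MvPolynomial.IsHomogeneous (det (∑ k, (X k : MvPolynomial (Fin 3) ℝ) •
      (A k).map MvPolynomial.C : Matrix (Fin d) (Fin d) (MvPolynomial (Fin 3) ℝ))) d := by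
    simpa using isHomogeneous_det_sum_X_smul A
  have hpq : p = det (∑ k, (X k : MvPolynomial (Fin 3) ℝ) •
      (A k).map MvPolynomial.C : Matrix (Fin d) (Fin d) (MvPolynomial (Fin 3) ℝ)) := by
    refine hp.eq_of_eval_eq_on_chart hQ 1 fun v hv => ?_
    rw [eval_det_sum_X_smul]
    have hv' : v = ![v 0, 1, v 2] := by
      ext i
      fin_cases i
      · rfl
      · exact hv
      · rfl
    rw [hv', h (v 0) (v 2)]
    congr 1
    simp [hA, Fin.sum_univ_three]
  rw [hpq, eval_det_sum_X_smul]
  congr 1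
  simp [hA, Fin.sum_univ_three]

end Literature.AlgebraicGeometry.DeterminantalHypersurfaces
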